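import Mathlib
import Summits.ValiantsHypothesis.ValiantsHypothesis.Theorems.KPlusLogSqLawLiftingFiniteBaseExcess
import Summits.ValiantsHypothesis.ValiantsHypothesis.Theorems.KPlusLogSqLawStaticTridiagonalSupport

/-!
# The near-tropical static tridiagonal REAL row, reduced to a PER-WINDOW EXCESS LAW (the typed α target of desk ruling R2080)

HONEST FRAMING.  Helper file toward the lifting crux `WeakLifting` (stmt-ValiantsHypothesis-19561; registered stubs of record
`stub_tridiagonalSectorB` / `stub_tridiagonalSectorBDiag`; aside `Lifting` stmt-ValiantsHypothesis-19772) of route `KPlusLogSqLaw`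
(cell `pub-symmetroid`, seat val-sym-lift-p1 g9, 2026-08-27).  A CONDITIONAL REDUCTION, kernel-checked: it takes as an explicit HYPOTHESIS a
per-window excess law for ONE patchworked pencil (no `def`, nothing asserted) and derives the in-window real bound from val-sym-lift-p3's
static tridiagonal chain law.  Nothing here asserts the excess law, `stub_tridiagonalSectorB`, `WeakLifting`, `TropicalB`, Conjecture B,
`MatrixDescartes` (stmt-ValiantsHypothesis-18050) or anything about VP ≠ VNP.

THE TYPED TARGET (α, R2080).  «PER-WINDOW EXCESS LAW with constant `c`» for the patchworked pencil `F_b` of a design `(d, v, ε)`: for all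
integer slopes `θ₁ < θ₂` and terms `p₁ ≠ p₂` with `p₁` dominant (`IsDominant`) at `θ₁` and `p₂` at `θ₂`, the number of distinct zeros of
`det F_b` in `(b^{θ₁}, b^{θ₂})` is at most `[termSign p₁ · termSign p₂ < 0] + c`.  KNOWN: `c = 0` in windows without hidden slopes at
`b ≥ N` (`card_roots_window_eq_of_noHidden`) and in windows whose hidden terms lie `≥ M` below the chord at `6 N (D_max+1) ≤ b^M`
(`card_roots_window_eq_of_chordMargin`); in general the excess is even and `≤ 2⌈H/2⌉` (`card_roots_window_le_alt_add_of_margin`).  Located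
numerics (HOME/val-sym-lift-p1/g9/tools): excess `∈ {0, 2, 4}` on random static tridiagonal designs, `m ≤ 8`.

THEOREM (`card_posRoots_le_of_windowExcess`).  If a STATIC TRIDIAGONAL design's patchworked pencil at a base `b ≥ N` satisfies the per-window
excess law with constant `c` along a dominant chain `P_0, …, P_r` (consecutive ones distinct) at integer slopes `θ_0 < ⋯ < θ_r` spanning the
present slopes, then `det F_b` has at most `(1 + c) · 66 (m−1)(⌊log₂(m−1)⌋+2)` distinct positive zeros.  PROOF: every positive zero lies in a
window (dominance at the `b^{θ_k}`, no zero below `b^{θ_0}` / above `b^{θ_r}` by the spanning condition); each window carries `≤ 1 + c`;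
`r ≤ 66(m−1)(⌊log₂(m−1)⌋+2)` by `StaticTridiagonal.chain_le_of_support`.  No `def`.  [folklore]
-/

set_option linter.dupNamespace false
set_option autoImplicit false

namespace Summit.ValiantsHypothesis.ValiantsHypothesis.Theorems.KPlusLogSqLaw.LocalDescartes

open Polynomial Finset
open scoped BigOperators
open Summit.ValiantsHypothesis.ValiantsHypothesis.Theorems.MatrixDescartes.Negative
  (patchMatrix tropWeight termSign IsDominant)
open Summit.ValiantsHypothesis.ValiantsHypothesis.Theorems.KPlusLogSqLaw.ExactPatchwork (exists_present_of_mem_support)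

variable {m K : ℕ}

/-- **WINDOW PARTITION BOUND** (any design): if `P_0, …, P_r` are dominant (`IsDominant`) at integer slopes `θ_0 < ⋯ < θ_r`, `N ≤ b`, the
chain spans the present slopes, and every window `(b^{θ_k}, b^{θ_{k+1}})` carries at most `B k` distinct zeros of `det F_b`, then `det F_b`
has at most `Σ_k B k` distinct positive zeros. [folklore] -/
theorem card_posRoots_le_sum_of_windows (b : ℝ) (hb : 1 < b) (d : Fin K → ℕ) (v ε : Fin m → Fin m → Fin K → ℤ)
    (hε : ∀ i j l, (ε i j l).natAbs ≤ 1)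
    (hN : (Fintype.card (Equiv.Perm (Fin m) × (Fin m → Fin K)) : ℝ) ≤ b)
    (r : ℕ) (θ : Fin (r + 1) → ℤ) (hθ : StrictMono θ) (P : Fin (r + 1) → Equiv.Perm (Fin m) × (Fin m → Fin K))
    (hP : ∀ k, IsDominant d v ε (θ k) (P k))
    (hrange : ∀ q : Equiv.Perm (Fin m) × (Fin m → Fin K), termSign ε q ≠ 0 →
      (∑ i, d ((P 0).2 i)) ≤ (∑ i, d (q.2 i)) ∧ (∑ i, d (q.2 i)) ≤ ∑ i, d ((P (Fin.last r)).2 i))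
    (B : Fin r → ℕ)
    (hB : ∀ k : Fin r, (((∑ l, (X : ℝ[X]) ^ d l • (patchMatrix b v ε l).map C).det).roots.toFinset.filter
      (fun x => b ^ θ k.castSucc < x ∧ x < b ^ θ k.succ)).card ≤ B k) :
    (((∑ l, (X : ℝ[X]) ^ d l • (patchMatrix b v ε l).map C).det).roots.toFinset.filter (fun t => 0 < t)).card
      ≤ ∑ k : Fin r, B k := by
  classical
  have hb0 : 0 < b := lt_trans one_pos hb
  set f := ((∑ l, (X : ℝ[X]) ^ d l • (patchMatrix b v ε l).map C).det) with hf
  have hN' : (Fintype.card (Equiv.Perm (Fin m) × (Fin m → Fin K)) : ℝ) ≤ b ^ (1 : ℕ) := by rw [pow_one]; exact hN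
  set a : Fin (r + 1) → ℝ := fun k => b ^ θ k with ha
  have hamono : StrictMono a := fun i j hij => zpow_lt_zpow_right₀ hb (hθ hij)
  have ha0 : 0 < a 0 := zpow_pos hb0 _
  have hapos : ∀ k, 0 < a k := fun k => zpow_pos hb0 _
  have hdom : ∀ k, ∑ s ∈ f.support.erase (∑ i, d ((P k).2 i)), |f.coeff s| * a k ^ s
      < |f.coeff (∑ i, d ((P k).2 i))| * a k ^ (∑ i, d ((P k).2 i)) :=
    fun k => monomial_dominant_of_margin b hb d v ε hε (θ k) 1 (P k) (hP k).1
      (margin_one_of_isDominant d v ε (θ k) (P k) (hP k)).2 hN'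
  have hcu : ∀ k, f.coeff (∑ i, d ((P k).2 i)) ≠ 0 := fun k => coeff_ne_zero_of_dominant f (hapos k) (hdom k)
  have hf0 : f ≠ 0 := fun h => hcu 0 (by rw [h, Polynomial.coeff_zero])
  set S := f.roots.toFinset.filter (fun t => 0 < t) with hS
  set W : Fin r → Finset ℝ := fun k => f.roots.toFinset.filter (fun x => b ^ θ k.castSucc < x ∧ x < b ^ θ k.succ) with hW
  have hcover : S ⊆ Finset.univ.biUnion W := by
    intro t ht
    rw [Finset.mem_filter] at ht
    have hroot : f.eval t = 0 := by
      have := ht.1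
      rw [Multiset.mem_toFinset, Polynomial.mem_roots hf0] at this
      exact this
    rcases root_trichotomy_of_chain f r (fun k => ∑ i, d ((P k).2 i)) a hamono ha0 hdom hroot with h1 | ⟨k, hk1, hk2⟩ | h3
    · exfalso
      refine eval_ne_zero_of_dominant_of_forall_le f (fun s hs => ?_) (hdom 0) ht.2 h1.le hroot
      obtain ⟨q, hq, hqs⟩ := exists_present_of_mem_support b hb0 d v ε hs
      rw [← hqs]; exact (hrange q hq).1
    · rw [Finset.mem_biUnion]
      exact ⟨k, Finset.mem_univ _, Finset.mem_filter.mpr ⟨ht.1, hk1, hk2⟩⟩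
    · exfalso
      refine eval_ne_zero_of_dominant_of_forall_ge f (hapos _) (fun s hs => ?_) (hdom (Fin.last r)) h3.le hroot
      obtain ⟨q, hq, hqs⟩ := exists_present_of_mem_support b hb0 d v ε hs
      rw [← hqs]; exact (hrange q hq).2
  calc S.card ≤ (Finset.univ.biUnion W).card := Finset.card_le_card hcover
    _ ≤ ∑ k, (W k).card := Finset.card_biUnion_le
    _ ≤ ∑ k, B k := Finset.sum_le_sum fun k _ => hB k

/-- **THE NEAR-TROPICAL STATIC TRIDIAGONAL REAL ROW FROM A PER-WINDOW EXCESS LAW** (conditional reduction; the α target of R2080 is the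
hypothesis `hexcess`, taken for ONE pencil and never asserted).  Let `(d, v, ε)` be a STATIC TRIDIAGONAL design (`ε i j l ≠ 0` only on the
band and only for the class `cls i j`, `|ε| ≤ 1`), `b > 1` with `N = m!·K^m ≤ b`, and `P_0, …, P_r` (consecutive ones distinct) dominant at
integer slopes `θ_0 < ⋯ < θ_r`, spanning the present slopes.  If every window of the chain carries at most
`[termSign P_k · termSign P_{k+1} < 0] + c` distinct zeros of `det F_b`, then `det F_b` has at most `(1 + c) · 66 (m−1)(⌊log₂(m−1)⌋+2)`
distinct positive zeros.  (`c = 0`: `…LiftingStaticTridiagonalRealRow`; the chain-length bound is lift-p3's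
`StaticTridiagonal.chain_le_of_support`.) [folklore] -/
theorem card_posRoots_le_of_windowExcess (b : ℝ) (hb : 1 < b) (d : Fin K → ℕ) (v ε : Fin m → Fin m → Fin K → ℤ)
    (cls : Fin m → Fin m → Fin K) (hε : ∀ i j l, (ε i j l).natAbs ≤ 1)
    (hstat : ∀ i j l, ε i j l ≠ 0 → (((i : ℕ) ≤ j + 1 ∧ (j : ℕ) ≤ i + 1) ∧ l = cls i j))
    (hN : (Fintype.card (Equiv.Perm (Fin m) × (Fin m → Fin K)) : ℝ) ≤ b)
    (r : ℕ) (θ : Fin (r + 1) → ℤ) (hθ : StrictMono θ) (P : Fin (r + 1) → Equiv.Perm (Fin m) × (Fin m → Fin K))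
    (hP : ∀ k, IsDominant d v ε (θ k) (P k)) (hne : ∀ k : Fin r, P k.castSucc ≠ P k.succ)
    (hrange : ∀ q : Equiv.Perm (Fin m) × (Fin m → Fin K), termSign ε q ≠ 0 →
      (∑ i, d ((P 0).2 i)) ≤ (∑ i, d (q.2 i)) ∧ (∑ i, d (q.2 i)) ≤ ∑ i, d ((P (Fin.last r)).2 i))
    (c : ℕ)
    (hexcess : ∀ k : Fin r, (((∑ l, (X : ℝ[X]) ^ d l • (patchMatrix b v ε l).map C).det).roots.toFinset.filter
      (fun x => b ^ θ k.castSucc < x ∧ x < b ^ θ k.succ)).card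
        ≤ (if termSign ε (P k.castSucc) * termSign ε (P k.succ) < 0 then 1 else 0) + c) :
    (((∑ l, (X : ℝ[X]) ^ d l • (patchMatrix b v ε l).map C).det).roots.toFinset.filter (fun t => 0 < t)).card
      ≤ (1 + c) * (66 * (m - 1) * (Nat.log 2 (m - 1) + 2)) := by
  classical
  have h1 := card_posRoots_le_sum_of_windows b hb d v ε hε hN r θ hθ P hP hrange
    (fun k => (if termSign ε (P k.castSucc) * termSign ε (P k.succ) < 0 then 1 else 0) + c) hexcess
  have hr : r ≤ 66 * (m - 1) * (Nat.log 2 (m - 1) + 2) := StaticTridiagonal.chain_le_of_support d v ε cls hstat r θ P hθ hP hne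
  have h2 : ∑ k : Fin r, ((if termSign ε (P k.castSucc) * termSign ε (P k.succ) < 0 then 1 else 0) + c) ≤ ∑ _k : Fin r, (1 + c) := by
    refine Finset.sum_le_sum fun k _ => ?_
    split_ifs <;> omega
  rw [Finset.sum_const, Finset.card_univ, Fintype.card_fin, smul_eq_mul] at h2
  calc _ ≤ _ := h1
    _ ≤ r * (1 + c) := h2
    _ ≤ (66 * (m - 1) * (Nat.log 2 (m - 1) + 2)) * (1 + c) := Nat.mul_le_mul_right _ hr
    _ = (1 + c) * (66 * (m - 1) * (Nat.log 2 (m - 1) + 2)) := Nat.mul_comm _ _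

end Summit.ValiantsHypothesis.ValiantsHypothesis.Theorems.KPlusLogSqLaw.LocalDescartes
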